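import Summits.NavierStokesRegularity.NavierStokesRegularity.Theorems.CircuitPump.Negative.LoadBearing

/-!
# Box sections are sound (crux `PerpetualPump.CircuitPump`, stmt-NavierStokesRegularity-1834;
# line `singular-clock-gspt`, sub-goal `toda_box_section` of `stub_clockBox`)

The trail/precursor sections of the lead's covering box for the `k = 1` DSS pump are coordinate
rectangles `[l, h] × [0, k] ⊂ (Fin 2 → ℝ)` with `l ≤ 0 ≤ h`, `0 ≤ k`. Such a set is the product
`Set.pi Set.univ B` of the compact convex intervals `B 0 = [l, h]`, `B 1 = [0, k]`, hence compact
(`isCompact_univ_pi`) and convex (`convex_pi`); it contains the zero function, so it is nonempty.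
[folklore]
-/

noncomputable section

-- the summit namespace `…NavierStokesRegularity.NavierStokesRegularity…` is the tree convention
set_option linter.dupNamespace false

namespace Summit.NavierStokesRegularity.NavierStokesRegularity.Theorems.PerpetualPumpCircuitPump

open Set

/-- The coordinate rectangle `{l ≤ y 0 ≤ h, 0 ≤ y 1 ≤ k}` in `Fin 2 → ℝ` is the product of the
intervals `[l, h]` (coordinate `0`) and `[0, k]` (coordinate `1`). -/
theorem boxSection_eq_pi (l h k : ℝ) :
    {y : Fin 2 → ℝ | l ≤ y 0 ∧ y 0 ≤ h ∧ 0 ≤ y 1 ∧ y 1 ≤ k} =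
      Set.pi Set.univ (fun i : Fin 2 => if i = 0 then Set.Icc l h else Set.Icc 0 k) := by
  ext y
  simp only [Set.mem_setOf_eq, Set.mem_univ_pi, Fin.forall_fin_two, Fin.isValue, if_true,
    show ((1 : Fin 2) = 0) = False from propext (by decide), if_false, Set.mem_Icc, and_assoc]

/-- **BOX SECTIONS ARE SOUND.** The trail/precursor sections of the lead's box are coordinate rectangles in
`Fin 2 → ℝ` containing `0`: compact, convex, nonempty. -/
theorem toda_box_section :
    ∀ (l h k : ℝ), l ≤ 0 → 0 ≤ h → 0 ≤ k →
      IsCompact {y : Fin 2 → ℝ | l ≤ y 0 ∧ y 0 ≤ h ∧ 0 ≤ y 1 ∧ y 1 ≤ k} ∧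
      Convex ℝ {y : Fin 2 → ℝ | l ≤ y 0 ∧ y 0 ≤ h ∧ 0 ≤ y 1 ∧ y 1 ≤ k} ∧
      ({y : Fin 2 → ℝ | l ≤ y 0 ∧ y 0 ≤ h ∧ 0 ≤ y 1 ∧ y 1 ≤ k}).Nonempty ∧
      (fun _ : Fin 2 => (0 : ℝ)) ∈ {y : Fin 2 → ℝ | l ≤ y 0 ∧ y 0 ≤ h ∧ 0 ≤ y 1 ∧ y 1 ≤ k} := by
  intro l h k hl hh hk
  have hmem : (fun _ : Fin 2 => (0 : ℝ)) ∈
      {y : Fin 2 → ℝ | l ≤ y 0 ∧ y 0 ≤ h ∧ 0 ≤ y 1 ∧ y 1 ≤ k} :=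
    ⟨hl, hh, le_rfl, hk⟩
  refine ⟨?_, ?_, ⟨_, hmem⟩, hmem⟩
  · rw [boxSection_eq_pi]
    exact isCompact_univ_pi fun i => by
      split_ifs
      · exact isCompact_Icc
      · exact isCompact_Icc
  · rw [boxSection_eq_pi]
    exact convex_pi fun i _ => by
      split_ifs
      · exact convex_Icc l h
      · exact convex_Icc 0 k

end Summit.NavierStokesRegularity.NavierStokesRegularity.Theorems.PerpetualPumpCircuitPump
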